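import Literature.Probability.LatticeModels.FKExplorationDomainMarkov
import Literature.Probability.LatticeModels.ObservableAprioriBound
import Literature.Probability.LatticeModels.MedialWindingBridge
import Literature.Probability.LatticeModels.MedialInterfaceMeasurability
import Literature.Probability.Percolation.FiniteEnergy
import Mathlib.Probability.ConditionalExpectation
import HarnessLib

/-!
# The domain Markov property of the medial exploration under Bernoulli bond percolation

Route `CardyComplexCone` (sub-problem `CriticalPhenomena/CardyFormulaZ2`), crux
`Summit.CriticalPhenomena.CardyFormulaZ2.Theses.CardyComplexCone.ParafermionToSLESixFamilies`
(item stmt-CriticalPhenomena-11389), line `caratheodory-net-slit-uniformity`, stub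
`stub_slitMartingaleData`, internal step (4a) "conditional bridge": the conditional twisted
passage amplitude given the exploration prefix is an EXACT discrete martingale, because for the
product measure the domain Markov property of the medial exploration `medialExploration D ω`
(`MedialInterface.lean` / `MedialInterfaceProofs.lean`) is "revealed edges frozen, the rest
i.i.d.". This file proves that sentence for the tree's objects, in the shape of the FK-Ising
template `LatticeModels.DiscreteDobrushin.setIntegral_explorationCylinder_fkInterfaceMeasure` /
`condExp_explorationFiltration_ae_eq_slitExpectation` / `martingale_slitExpectation`
(`FKExplorationDomainMarkov.lean`, Duminil-Copin–Smirnov 2012 Lemma 6.6 for the random-cluster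
measure), for the Bernoulli measure `bondPercolation (zdGraph 2) p` (any edge density `p`):

* `revealedFreeEdges hD ω₀ n` — the free explored lattice edges `e_i(ω₀)`, `i < min n N(ω₀)`, of
  the prefix event `C_n(ω₀) = explorationCylinder hD ω₀ n`; the prefix event is the cylinder
  "agree with `ω₀` on them" (`explorationCylinder_eq_setOf_revealedFreeEdges`, from the tree's
  `mem_explorationCylinder_iff_free`), hence an event of the edge σ-algebra
  `edgeSigma (revealedFreeEdges hD ω₀ n)` (`measurableSet_edgeSigma_explorationCylinder`);
* `freeze hD ω₀ n ω = ω \ R ∪ (ω₀ ∩ R)` — the configuration frozen to `ω₀` on the revealed free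
  edges `R` and equal to `ω` elsewhere; it is the identity on `C_n(ω₀)` (`freeze_eq_self_of_mem`)
  and `σ(Rᶜ)`-measurable (`measurable_freeze_edgeSigma`);
* `percSlitExpectation hD p n g ω₀ = ∫ g (freeze hD ω₀ n ω) dP_p(ω)` — the expectation of `g` with
  the revealed edges frozen and the others resampled (the percolation "slit expectation");
* **`setIntegral_explorationCylinder_bondPercolation`** — the domain Markov property on atoms:
  `∫_{C_n(ω₀)} g dP_p = P_p(C_n(ω₀)) • percSlitExpectation hD p n g ω₀` for bounded strongly
  measurable Banach-valued `g` (independence of `σ(R)` and `σ(Rᶜ)` under the product measure,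
  `bondPercolation_indep_edgeSigma`, through `condExp_indep_eq`);
* **`condExp_explorationFiltration_ae_eq_percSlitExpectation`** — `P_p[g | 𝓕_n] = percSlitExpectation
  … g` a.e. for the exploration filtration `explorationFiltration hD` of the tree (countable
  decomposition of `𝓕_n`-events into prefix events, as in the FK file);
* **`martingale_percSlitExpectation`** — `n ↦ percSlitExpectation hD p n g` is a martingale for the
  exploration filtration under `P_p` (registered glue sub-goal of the skeleton), in particular for
  the twisted passage sum of the spin-`1/3` parafermionic observable
  (`martingale_percSlitExpectation_passageSum`).
-/

noncomputable section

open MeasureTheory ProbabilityTheory Set Filter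
open Literature.Probability Literature.Probability.LatticeModels Literature.Probability.Percolation
open Literature.Probability.LatticeModels.DiscreteDobrushin

namespace Summit.CriticalPhenomena.CardyFormulaZ2.Cruxes.ParafermionToSLESixFamilies.CaratheodoryNetSlitUniformity

variable {D : DiscreteDobrushin} (hD : D.IsZdAdmissible)

/-! ### The revealed free edges and the frozen configuration -/

/-- **The revealed free edges** of the prefix event `C_n(ω₀)`: the free explored lattice edges
`e_i(ω₀)` (`exploredEdge`), `i < min n N(ω₀)` (`exitTime`), i.e. the edges whose states the first
`n` steps of the exploration of `ω₀` have read off `ω₀` (the other explored edges — wired `A`–`A`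
edges and edges touching the dual-wired arc `B` — are forced by the boundary condition). -/
def revealedFreeEdges (ω₀ : BondConfig (Site 2)) (n : ℕ) : Set (Sym2 (Site 2)) :=
  {e | ∃ i < min n (exitTime hD ω₀), exploredEdge hD ω₀ i = e ∧ D.IsFreeEdge e}

/-- **The frozen configuration**: `ω` with its states on the revealed free edges of `C_n(ω₀)`
replaced by those of `ω₀`. -/
def freeze (ω₀ : BondConfig (Site 2)) (n : ℕ) (ω : BondConfig (Site 2)) : BondConfig (Site 2) :=
  ω \ revealedFreeEdges hD ω₀ n ∪ (ω₀ ∩ revealedFreeEdges hD ω₀ n)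

/-- **The percolation slit expectation** of `g` at depth `n`: the `P_p`-expectation of `g` over
configurations frozen to `ω₀` on the revealed free edges of `C_n(ω₀)` and resampled elsewhere —
the expectation of `g` "in the slit domain `Ω_δ ∖ γ₀[0, n+1]` with the boundary conditions
inherited from the exploration", as a function of `ω₀`. -/
def percSlitExpectation (p : unitInterval) (n : ℕ) {E : Type*} [NormedAddCommGroup E]
    [NormedSpace ℝ E] (g : BondConfig (Site 2) → E) (ω₀ : BondConfig (Site 2)) : E :=
  ∫ ω, g (freeze hD ω₀ n ω) ∂bondPercolation (zdGraph 2) p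

variable {hD}

/-- **The prefix event is the cylinder of the revealed free edges**: `ω ∈ C_n(ω₀)` iff `ω` and
`ω₀` agree on every revealed free edge (the tree's `mem_explorationCylinder_iff_free`). -/
theorem explorationCylinder_eq_setOf_revealedFreeEdges (ω₀ : BondConfig (Site 2)) (n : ℕ) :
    explorationCylinder hD ω₀ n = {ω | ∀ e ∈ revealedFreeEdges hD ω₀ n, e ∈ ω ↔ e ∈ ω₀} := by
  ext ω
  rw [mem_explorationCylinder_iff_free, Set.mem_setOf_eq]
  constructor
  · rintro h e ⟨i, hi, rfl, hf⟩
    exact h i hi hf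
  · intro h i hi hf
    exact h _ ⟨i, hi, rfl, hf⟩

/-- On the prefix event the configurations agree with `ω₀` on the revealed free edges. -/
theorem inter_revealedFreeEdges_eq_of_mem {ω₀ ω : BondConfig (Site 2)} {n : ℕ}
    (h : ω ∈ explorationCylinder hD ω₀ n) :
    ω ∩ revealedFreeEdges hD ω₀ n = ω₀ ∩ revealedFreeEdges hD ω₀ n := by
  rw [explorationCylinder_eq_setOf_revealedFreeEdges] at h
  ext e
  exact ⟨fun he ↦ ⟨(h e he.2).1 he.1, he.2⟩, fun he ↦ ⟨(h e he.2).2 he.1, he.2⟩⟩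

/-- **Freezing is the identity on the prefix event.** -/
theorem freeze_eq_self_of_mem {ω₀ ω : BondConfig (Site 2)} {n : ℕ}
    (h : ω ∈ explorationCylinder hD ω₀ n) : freeze hD ω₀ n ω = ω := by
  rw [freeze, ← inter_revealedFreeEdges_eq_of_mem h, Set.sdiff_union_inter]

/-- The revealed free edges are a class function of the prefix event (explored edges and the
truncated exit time are, `exploredEdge_eq_of_mem_explorationCylinder`,
`min_exitTime_eq_of_mem_explorationCylinder`). -/
theorem revealedFreeEdges_eq_of_mem {ω₀ ω : BondConfig (Site 2)} {n : ℕ}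
    (h : ω ∈ explorationCylinder hD ω₀ n) :
    revealedFreeEdges hD ω n = revealedFreeEdges hD ω₀ n := by
  have hm := min_exitTime_eq_of_mem_explorationCylinder h
  ext e
  simp only [revealedFreeEdges, Set.mem_setOf_eq]
  constructor
  · rintro ⟨i, hi, rfl, hf⟩
    rw [hm] at hi
    exact ⟨i, hi, (exploredEdge_eq_of_mem_explorationCylinder h hi.le).symm, hf⟩
  · rintro ⟨i, hi, rfl, hf⟩
    refine ⟨i, by rwa [hm], ?_, hf⟩
    exact exploredEdge_eq_of_mem_explorationCylinder h hi.le

/-- Freezing is a class function of the prefix event in `ω₀`. -/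
theorem freeze_eq_of_mem {ω₀ ω : BondConfig (Site 2)} {n : ℕ}
    (h : ω ∈ explorationCylinder hD ω₀ n) : freeze hD ω n = freeze hD ω₀ n := by
  funext ω'
  rw [freeze, freeze, revealedFreeEdges_eq_of_mem h, inter_revealedFreeEdges_eq_of_mem h]

/-- The slit expectation is a class function of the prefix event. -/
theorem percSlitExpectation_eq_of_mem {p : unitInterval} {n : ℕ} {E : Type*}
    [NormedAddCommGroup E] [NormedSpace ℝ E] (g : BondConfig (Site 2) → E)
    {ω₀ ω : BondConfig (Site 2)} (h : ω ∈ explorationCylinder hD ω₀ n) :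
    percSlitExpectation hD p n g ω = percSlitExpectation hD p n g ω₀ := by
  simp only [percSlitExpectation, freeze_eq_of_mem h]

/-! ### Measurability -/

/-- The prefix event is determined by the revealed free edges. -/
theorem determinedBy_explorationCylinder (ω₀ : BondConfig (Site 2)) (n : ℕ) :
    DeterminedBy (explorationCylinder hD ω₀ n) (revealedFreeEdges hD ω₀ n) := by
  rw [determinedBy_iff]
  intro ω ω' hωω'
  rw [explorationCylinder_eq_setOf_revealedFreeEdges]
  simp only [Set.mem_setOf_eq]
  have key : ∀ e ∈ revealedFreeEdges hD ω₀ n, (e ∈ ω ↔ e ∈ ω') := fun e he ↦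
    ⟨fun h ↦ ((Set.ext_iff.1 hωω' e).1 ⟨h, he⟩).1, fun h ↦ ((Set.ext_iff.1 hωω' e).2 ⟨h, he⟩).1⟩
  exact forall₂_congr fun e he ↦ by rw [key e he]

/-- **The prefix event is an event of the σ-algebra of the revealed free edges.** -/
theorem measurableSet_edgeSigma_explorationCylinder (ω₀ : BondConfig (Site 2)) (n : ℕ) :
    MeasurableSet[edgeSigma (revealedFreeEdges hD ω₀ n)] (explorationCylinder hD ω₀ n) :=
  (determinedBy_explorationCylinder ω₀ n).measurableSet_edgeSigma
    (measurableSet_explorationCylinder ω₀ n)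

/-- Freezing is measurable (product σ-algebra). -/
theorem measurable_freeze (ω₀ : BondConfig (Site 2)) (n : ℕ) : Measurable (freeze hD ω₀ n) :=
  measurable_set_iff.2 fun e ↦ ((measurable_set_mem e).and measurable_const).or measurable_const

/-- **Freezing is `σ(Rᶜ)`-measurable**, `R` the revealed free edges: it only reads the edges off
`R`. -/
theorem measurable_freeze_edgeSigma (ω₀ : BondConfig (Site 2)) (n : ℕ) :
    Measurable[edgeSigma (revealedFreeEdges hD ω₀ n)ᶜ] (freeze hD ω₀ n) := by
  have h1 : Measurable fun ζ : BondConfig (Site 2) ↦ ζ ∪ (ω₀ ∩ revealedFreeEdges hD ω₀ n) :=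
    measurable_set_iff.2 fun e ↦ (measurable_set_mem e).or measurable_const
  have h2 : freeze hD ω₀ n = (fun ζ : BondConfig (Site 2) ↦ ζ ∪ (ω₀ ∩ revealedFreeEdges hD ω₀ n)) ∘
      fun ω ↦ ω ∩ (revealedFreeEdges hD ω₀ n)ᶜ := by
    funext ω; rfl
  rw [h2]
  exact h1.comp (measurable_inter_edgeSigma _)

/-! ### The domain Markov property on atoms -/

section Atoms

variable (p : unitInterval) {E : Type*} [NormedAddCommGroup E] [NormedSpace ℝ E] [CompleteSpace E]

/-- **Independence step**: for `g` strongly measurable and bounded, the integral over the prefix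
event of `g ∘ freeze` factorises: `∫_{C_n(ω₀)} g (freeze ω) dP_p = P_p(C_n(ω₀)) • ∫ g (freeze ω) dP_p`
(`C_n(ω₀) ∈ σ(R)`, `g ∘ freeze` is `σ(Rᶜ)`-measurable, and `σ(R) ⊥ σ(Rᶜ)` under the product
measure, `bondPercolation_indep_edgeSigma`; conditional-expectation form `condExp_indep_eq`). -/
theorem setIntegral_explorationCylinder_comp_freeze {g : BondConfig (Site 2) → E}
    (hg : StronglyMeasurable g) {K : ℝ} (hgK : ∀ ω, ‖g ω‖ ≤ K) (ω₀ : BondConfig (Site 2)) (n : ℕ) :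
    ∫ ω in explorationCylinder hD ω₀ n, g (freeze hD ω₀ n ω) ∂bondPercolation (zdGraph 2) p =
      (bondPercolation (zdGraph 2) p).real (explorationCylinder hD ω₀ n) •
        percSlitExpectation hD p n g ω₀ := by
  set μ := bondPercolation (zdGraph 2) p with hμ
  set R := revealedFreeEdges hD ω₀ n with hR
  set G : BondConfig (Site 2) → E := fun ω ↦ g (freeze hD ω₀ n ω) with hG
  have hRle : edgeSigma R ≤ (Set.instMeasurableSpace : MeasurableSpace (BondConfig (Site 2))) :=
    edgeSigma_le R
  have hRcle : edgeSigma Rᶜ ≤ (Set.instMeasurableSpace : MeasurableSpace (BondConfig (Site 2))) :=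
    edgeSigma_le Rᶜ
  haveI : IsFiniteMeasure (μ.trim hRle) := isFiniteMeasure_trim hRle
  -- `G` is `σ(Rᶜ)`-strongly measurable and integrable
  have hGm : StronglyMeasurable[edgeSigma Rᶜ] G :=
    hg.comp_measurable (measurable_freeze_edgeSigma ω₀ n)
  have hGint : Integrable G μ := by
    refine Integrable.of_bound (hg.comp_measurable (measurable_freeze ω₀ n)).aestronglyMeasurable K
      (ae_of_all _ fun ω ↦ hgK _)
  -- independence: `μ[G | σ(R)] = ∫ G` a.e.
  have hind : Indep (edgeSigma Rᶜ) (edgeSigma R) μ :=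
    bondPercolation_indep_edgeSigma (zdGraph 2) p disjoint_compl_left
  have hce : μ[G|edgeSigma R] =ᵐ[μ] fun _ ↦ ∫ ω, G ω ∂μ := condExp_indep_eq hRcle hRle hGm hind
  have hC : MeasurableSet[edgeSigma R] (explorationCylinder hD ω₀ n) :=
    measurableSet_edgeSigma_explorationCylinder ω₀ n
  calc ∫ ω in explorationCylinder hD ω₀ n, G ω ∂μ
      = ∫ ω in explorationCylinder hD ω₀ n, (μ[G|edgeSigma R]) ω ∂μ :=
        (setIntegral_condExp hRle hGint hC).symm
    _ = ∫ ω in explorationCylinder hD ω₀ n, (fun _ ↦ ∫ ω', G ω' ∂μ) ω ∂μ :=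
        setIntegral_congr_ae (hRle _ hC) (hce.mono fun ω h _ ↦ h)
    _ = μ.real (explorationCylinder hD ω₀ n) • percSlitExpectation hD p n g ω₀ := by
        rw [setIntegral_const]
        rfl

/-- **The domain Markov property of the medial exploration under `P_p`, on atoms** (percolation
twin of `setIntegral_explorationCylinder_fkInterfaceMeasure`): for admissible data, every `ω₀`,
`n` and every bounded strongly measurable Banach-valued `g`,
`∫_{C_n(ω₀)} g dP_p = P_p(C_n(ω₀)) • ∫ g (freeze hD ω₀ n ω) dP_p(ω)` — conditionally on the first
`n` steps of the exploration, the revealed free edges are frozen and all other edges are again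
i.i.d. Bernoulli(`p`). -/
theorem setIntegral_explorationCylinder_bondPercolation {g : BondConfig (Site 2) → E}
    (hg : StronglyMeasurable g) {K : ℝ} (hgK : ∀ ω, ‖g ω‖ ≤ K) (ω₀ : BondConfig (Site 2)) (n : ℕ) :
    ∫ ω in explorationCylinder hD ω₀ n, g ω ∂bondPercolation (zdGraph 2) p =
      (bondPercolation (zdGraph 2) p).real (explorationCylinder hD ω₀ n) •
        percSlitExpectation hD p n g ω₀ := by
  rw [← setIntegral_explorationCylinder_comp_freeze p hg hgK ω₀ n]
  exact setIntegral_congr_fun (measurableSet_explorationCylinder ω₀ n)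
    fun ω hω ↦ by rw [freeze_eq_self_of_mem hω]

/-- Probability form: `P_p(C_n(ω₀) ∩ T) = P_p(C_n(ω₀)) · P_p{ω | freeze hD ω₀ n ω ∈ T}` for every
measurable `T`. -/
theorem bondPercolation_real_explorationCylinder_inter (ω₀ : BondConfig (Site 2)) (n : ℕ)
    {T : Set (BondConfig (Site 2))} (hT : MeasurableSet T) :
    (bondPercolation (zdGraph 2) p).real (explorationCylinder hD ω₀ n ∩ T) =
      (bondPercolation (zdGraph 2) p).real (explorationCylinder hD ω₀ n) *
        (bondPercolation (zdGraph 2) p).real (freeze hD ω₀ n ⁻¹' T) := by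
  set μ := bondPercolation (zdGraph 2) p with hμ
  have hpre : MeasurableSet (freeze hD ω₀ n ⁻¹' T) := measurable_freeze ω₀ n hT
  have h1 : ∫ ω in explorationCylinder hD ω₀ n, T.indicator (1 : BondConfig (Site 2) → ℝ) ω ∂μ =
      μ.real (explorationCylinder hD ω₀ n ∩ T) := by
    rw [integral_indicator_one hT, measureReal_restrict_apply hT, Set.inter_comm]
  have h2 : percSlitExpectation hD p n (T.indicator (1 : BondConfig (Site 2) → ℝ)) ω₀ =
      μ.real (freeze hD ω₀ n ⁻¹' T) := by
    rw [← integral_indicator_one hpre, percSlitExpectation]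
    refine integral_congr_ae (ae_of_all _ fun ω ↦ ?_)
    show T.indicator (1 : BondConfig (Site 2) → ℝ) (freeze hD ω₀ n ω) = (freeze hD ω₀ n ⁻¹' T).indicator 1 ω
    by_cases hω : freeze hD ω₀ n ω ∈ T
    · rw [Set.indicator_of_mem hω, Set.indicator_of_mem (Set.mem_preimage.2 hω)]
      rfl
    · rw [Set.indicator_of_notMem hω, Set.indicator_of_notMem (fun h ↦ hω (Set.mem_preimage.1 h))]
  have h := setIntegral_explorationCylinder_bondPercolation (hD := hD) p (E := ℝ)
    (g := T.indicator 1) ((stronglyMeasurable_const (b := (1 : ℝ))).indicator hT) (K := 1)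
    (fun ω ↦ by
      by_cases hω : ω ∈ T
      · rw [Set.indicator_of_mem hω, Pi.one_apply, norm_one]
      · rw [Set.indicator_of_notMem hω, norm_zero]; exact zero_le_one) ω₀ n
  rwa [h1, h2, smul_eq_mul] at h

end Atoms

/-! ### Conditional expectations given the exploration prefix, and the martingale -/

section Filtration

variable (p : unitInterval) {E : Type*} [NormedAddCommGroup E] [NormedSpace ℝ E] [CompleteSpace E]

omit [CompleteSpace E] in
/-- The slit expectation of a bounded function is bounded by the same constant. -/
theorem norm_percSlitExpectation_le {g : BondConfig (Site 2) → E} {K : ℝ} (hgK : ∀ ω, ‖g ω‖ ≤ K)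
    (n : ℕ) (ω₀ : BondConfig (Site 2)) : ‖percSlitExpectation hD p n g ω₀‖ ≤ K := by
  have hK : 0 ≤ K := (norm_nonneg _).trans (hgK ∅)
  refine (norm_integral_le_integral_norm _).trans ?_
  calc ∫ ω, ‖g (freeze hD ω₀ n ω)‖ ∂bondPercolation (zdGraph 2) p
      ≤ ∫ _, K ∂bondPercolation (zdGraph 2) p :=
        integral_mono_of_nonneg (ae_of_all _ fun _ ↦ norm_nonneg _) (integrable_const K)
          (ae_of_all _ fun ω ↦ hgK _)
    _ = K := by simp

omit [CompleteSpace E] in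
/-- The slit expectation is `𝓕_n`-strongly measurable (a class function of the prefix events). -/
theorem stronglyMeasurable_percSlitExpectation (n : ℕ) (g : BondConfig (Site 2) → E) :
    StronglyMeasurable[explorationFiltration hD n] (percSlitExpectation hD p n g) :=
  stronglyMeasurable_explorationFiltration_of_forall_mem fun _ _ h ↦ percSlitExpectation_eq_of_mem g h

omit [CompleteSpace E] in
/-- The slit expectation of a bounded function is integrable. -/
theorem integrable_percSlitExpectation {g : BondConfig (Site 2) → E} {K : ℝ}
    (hgK : ∀ ω, ‖g ω‖ ≤ K) (n : ℕ) :
    Integrable (percSlitExpectation hD p n g) (bondPercolation (zdGraph 2) p) :=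
  Integrable.of_bound
    (((stronglyMeasurable_percSlitExpectation p n g).mono
      ((explorationFiltration hD).le n)).aestronglyMeasurable) K
    (ae_of_all _ fun ω ↦ norm_percSlitExpectation_le p hgK n ω)

/-- **The domain Markov property on atoms, conditional-expectation form**: over a prefix event,
`g` and its slit expectation have the same integral. -/
theorem setIntegral_explorationCylinder_percSlitExpectation {g : BondConfig (Site 2) → E}
    (hg : StronglyMeasurable g) {K : ℝ} (hgK : ∀ ω, ‖g ω‖ ≤ K) (ω₀ : BondConfig (Site 2)) (n : ℕ) :
    ∫ ω in explorationCylinder hD ω₀ n, percSlitExpectation hD p n g ω ∂bondPercolation (zdGraph 2) p =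
      ∫ ω in explorationCylinder hD ω₀ n, g ω ∂bondPercolation (zdGraph 2) p := by
  rw [setIntegral_congr_fun (measurableSet_explorationCylinder ω₀ n)
      (fun ω hω ↦ percSlitExpectation_eq_of_mem (p := p) g hω), setIntegral_const,
    setIntegral_explorationCylinder_bondPercolation p hg hgK ω₀ n]

/-- **Conditional expectations given the exploration prefix** (percolation twin of
`condExp_explorationFiltration_ae_eq_slitExpectation`): for admissible data and every bounded
strongly measurable Banach-valued `g`, `P_p[g | 𝓕_n](ω₀) = ∫ g (freeze hD ω₀ n ω) dP_p(ω)` for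
`P_p`-a.e. `ω₀`, where `𝓕_n = explorationFiltration hD n` is generated by the first `n + 2`
medial vertices of the exploration. -/
theorem condExp_explorationFiltration_ae_eq_percSlitExpectation {g : BondConfig (Site 2) → E}
    (hg : StronglyMeasurable g) {K : ℝ} (hgK : ∀ ω, ‖g ω‖ ≤ K) (n : ℕ) :
    (bondPercolation (zdGraph 2) p)[g | explorationFiltration hD n] =ᵐ[bondPercolation (zdGraph 2) p]
      percSlitExpectation hD p n g := by
  set μ := bondPercolation (zdGraph 2) p with hμ
  have hgint : Integrable g μ :=
    Integrable.of_bound hg.aestronglyMeasurable K (ae_of_all _ fun ω ↦ hgK _)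
  symm
  refine ae_eq_condExp_of_forall_setIntegral_eq ((explorationFiltration hD).le n) hgint
    (fun s _ _ ↦ (integrable_percSlitExpectation p hgK n).integrableOn) (fun s hs _ ↦ ?_)
    (stronglyMeasurable_percSlitExpectation p n g).aestronglyMeasurable
  -- `s` is a countable disjoint union of fibres of the prefix map
  obtain ⟨S, rfl⟩ := measurableSet_explorationFiltration_iff.1 hs
  rw [← Set.biUnion_preimage_singleton, Set.biUnion_eq_iUnion]
  have hmeas : ∀ l : S, MeasurableSet (explorationPrefix D n ⁻¹' {(l : List MedialVertex)}) := fun l ↦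
    measurableSet_preimage_explorationPrefix hD n _
  have hdisj : Pairwise (Function.onFun Disjoint
      fun l : S ↦ explorationPrefix D n ⁻¹' {(l : List MedialVertex)}) := by
    intro l l' hll'
    refine Disjoint.preimage _ (Set.disjoint_singleton.2 ?_)
    exact fun h ↦ hll' (Subtype.ext h)
  rw [integral_iUnion hmeas hdisj (integrable_percSlitExpectation p hgK n).integrableOn,
    integral_iUnion hmeas hdisj hgint.integrableOn]
  refine tsum_congr fun l ↦ ?_
  by_cases h : ∃ ω₀, explorationPrefix D n ω₀ = l
  · obtain ⟨ω₀, hω₀⟩ := h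
    rw [← hω₀, ← explorationCylinder_eq_preimage_explorationPrefix (hD := hD)]
    exact setIntegral_explorationCylinder_percSlitExpectation p hg hgK ω₀ n
  · have he : explorationPrefix D n ⁻¹' {(l : List MedialVertex)} = ∅ :=
      Set.eq_empty_of_forall_notMem fun ω hω ↦ h ⟨ω, hω⟩
    rw [he, setIntegral_empty, setIntegral_empty]

/-- **Percolation slit expectations are martingales** (registered glue of the skeleton; the
percolation twin of Duminil-Copin–Smirnov's Lemma 6.6, lattice half,
`martingale_slitExpectation`): for admissible data, every edge density `p` and every bounded
strongly measurable Banach-valued `g`, the process `n ↦ (ω₀ ↦ ∫ g (freeze hD ω₀ n ω) dP_p(ω))`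
is a martingale for the exploration filtration under `P_p` — the conditional expectation of `g`
given the first `n` steps of the medial exploration, as an everywhere-defined class function. -/
theorem martingale_percSlitExpectation : ∀ {D : DiscreteDobrushin} (hD : D.IsZdAdmissible) (p : unitInterval) {E : Type*} [NormedAddCommGroup E] [NormedSpace ℝ E] [CompleteSpace E] {g : BondConfig (Site 2) → E}, StronglyMeasurable g → ∀ {K : ℝ}, (∀ ω, ‖g ω‖ ≤ K) → Martingale (fun n => percSlitExpectation hD p n g) (explorationFiltration hD) (bondPercolation (zdGraph 2) p) := by
  intro D hD p E _ _ _ g hg K hgK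
  refine ⟨fun n ↦ stronglyMeasurable_percSlitExpectation p n g, fun i j hij ↦ ?_⟩
  set μ := bondPercolation (zdGraph 2) p with hμ
  have hi := condExp_explorationFiltration_ae_eq_percSlitExpectation (hD := hD) p hg hgK i
  have hj := condExp_explorationFiltration_ae_eq_percSlitExpectation (hD := hD) p hg hgK j
  calc μ[percSlitExpectation hD p j g | explorationFiltration hD i]
      =ᵐ[μ] μ[μ[g | explorationFiltration hD j] | explorationFiltration hD i] :=
        condExp_congr_ae hj.symm
    _ =ᵐ[μ] μ[g | explorationFiltration hD i] :=
        condExp_condExp_of_le ((explorationFiltration hD).mono hij) ((explorationFiltration hD).le j)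
    _ =ᵐ[μ] percSlitExpectation hD p i g := hi

omit [CompleteSpace E] in
/-- At depth `0` nothing is revealed: the slit expectation is the plain expectation (for the
twisted passage sum of the exploration, the crux's observable `obs E z`). -/
theorem percSlitExpectation_zero (g : BondConfig (Site 2) → E) (ω₀ : BondConfig (Site 2)) :
    percSlitExpectation hD p 0 g ω₀ = ∫ ω, g ω ∂bondPercolation (zdGraph 2) p := by
  have hR : revealedFreeEdges hD ω₀ 0 = ∅ := by
    refine Set.eq_empty_of_forall_notMem fun e ↦ ?_
    rintro ⟨i, hi, -, -⟩
    rw [Nat.zero_min] at hi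
    exact Nat.not_lt_zero i hi
  have hf : ∀ ω, freeze hD ω₀ 0 ω = ω := fun ω ↦ by simp [freeze, hR]
  simp only [percSlitExpectation, hf]

/-- **The discrete observable martingale of the spin-`σ` parafermion, lattice form.** For
admissible data `E`, every edge density `p`, spin `σ` and medial vertex `z`, the percolation slit
expectations of the twisted passage sum `∑_{passages of γ(ω) through z} e^{-iσ W_γ}`
(`MedialPath.passageSum (medialExploration E ω) E.δ σ z`, the integrand of the crux's observable
`obs`; bounded by `2`, `norm_passageSum_fkInterface_le_two`, and a measurable function of the
exploration, `measurable_of_medialExploration`) form a complex martingale for the exploration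
filtration under `P_p` — the exact discrete martingale `n ↦ E[X_z | 𝓕_n]` of step (4a). -/
theorem martingale_percSlitExpectation_passageSum {E : DiscreteDobrushin} (hE : E.IsZdAdmissible)
    (p : unitInterval) (spin : ℝ) (z : MedialVertex) :
    Martingale (fun n ↦ percSlitExpectation hE p n
        (fun ω ↦ MedialPath.passageSum (medialExploration E ω) E.δ spin z))
      (explorationFiltration hE) (bondPercolation (zdGraph 2) p) := by
  have hm : Measurable fun ω ↦ MedialPath.passageSum (medialExploration E ω) E.δ spin z :=
    measurable_of_medialExploration E fun ω ω' h ↦ by simp only [h]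
  refine martingale_percSlitExpectation hE p hm.stronglyMeasurable (K := 2) fun ω ↦ ?_
  rw [MedialPath.passageSum_medialExploration_eq]
  exact norm_passageSum_fkInterface_le_two hE ω E.δ spin z

end Filtration

end Summit.CriticalPhenomena.CardyFormulaZ2.Cruxes.ParafermionToSLESixFamilies.CaratheodoryNetSlitUniformity

end
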